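import Summits.QuantumFields.YangMills.Theorems.BalabanUVNodesN07TowerCentresCoverPointwise
import Literature.MathematicalPhysics.QuantumFieldTheory.Balaban1983to89.Node00.TorusCoverLevels
import Literature.MathematicalPhysics.QuantumFieldTheory.Balaban1983to89.T4AxialGaugeSmallField
import Literature.MathematicalPhysics.QuantumFieldTheory.Balaban1983to89.B8Eq17ClassAkV1
import HarnessLib

/-!
# N07 [B11] (= [15] = [Balaban1985Variational]) Sect. F ∕ [I] (0.1)–(0.3) ∕ [6] (1.7) — **THE BOX PLAQUETTES UNDER THE TOWER BLOCKS OF AN ALIGNED REGION, AND THE CELL's FINE SHADOW**: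
# the two geometric binders `hS₀` ∕ `hyS` of the (σ2) supplier, discharged by cover bookkeeping

Cell `pub-ymgap`, width seat `pub-ymgap-dag-n07-w3` g13 (junction side of the K0 road; (σ2) geometry).  `--kind proof --supports stmt-QuantumFields-20541 --as helper` (K0⁷; count-neutral;
THEOREMS ONLY, 0 `def`).  [I] = [Balaban1987RG1]; [6] = [Balaban1985RegularSpaces]; [15] = [Balaban1985Variational].  CONSUMED BY NAME: dag-n07-e's `Node00.TorusCoverLevels.{iterBlockOf_cover,
blockMap_blockMap, coverAt}`, this seat's ✓p749305 `Node00.…RecordDentZd.blockMap_pow_add_ctrShift` and ✓p756357 `…N07TowerCentresCoverPointwise.blockMap_add_smul_const`, dag-n05-d's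
`B8Eq119TwistedAxialRec.{UnderZ, flmZ, underZ_iff_flmZ_eq, ctrShift_add}`, `QuantumLattice.{blockMap, blockBase, blockMap_blockBase_add_of_lt}`, `T4AxialGaugeSmallField.{castSite, boxPlaqs}`,
node00-def-R's `B8Eq17ClassAkV1.{plaqsOf, plaqsOf_mono}`.

WHY.  The (σ2) supplier of the junction (this seat's `…N07SymTauTowerStatementOfFinePlaquettes` ∕ `…N07SymTauCellRowOfFinePlaquettes`, INTENT-21∕22) carries two GEOMETRIC binders:
`hS₀ : ∀ n < k, ∀ w ∈ S, ∃ t, castSite t = iterBlockOf (n+1) w ∧ boxPlaqs (L^{n+1}·t) (L^{n+1}·t + L^{n+1} − 1) ⊆ S₀` (the fine box under every tower block over `S` lies in the plaquette set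
of the ONE fine letter — row (17) gives `S₀ = plaqsOf Ω_{j−1}` on the collar of the datum) and `hyS : ∀ w under y, π(w + c_k·𝟙) ∈ S` (the fine shadow of the cell anchor covers into `S`).
THIS FILE discharges both by cover bookkeeping for the natural choice `S := π '' X`, `X` contained in an `L^j`-ALIGNED region `Y ⊆ ℤᵈ` (a union of `L^j`-boxes `[L^j·t, L^j·t + L^j − 1]`,
e.g. the anchored lift of the collar) whose image lies in `Ω′`: the `(n+1)`-block of `π x` is `π_{n+1}⌊x∕L^{n+1}⌋` (`iterBlockOf_cover`), its fine box is the `L^{n+1}`-box of `⌊x∕L^{n+1}⌋`,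
which lies in the `L^j`-box of `⌊x∕L^j⌋ ⊆ Y` (`n + 1 ≤ j`, floor divisions compose), so its plaquettes' base points are in `π '' Y ⊆ Ω′`; and `w` under `y` at depth `j′` means
`⌊(w + c_k·𝟙)∕L^{j′}⌋ = y + c_{k−j′}·𝟙` (`c_k = L^{j′}·c_{k−j′} + c_{j′}`), so the anchored image of the cell's shadow is the image of ONE aligned `L^{j′}`-box.  Pure bookkeeping: NO estimate.

WHAT IS PROVED (sorry-free; every `Params`, odd `L`).
§1 `blockMap_pow_eq_of_mem_box` (a point of `[L^m·t, L^m·t + L^m − 1]` has `L^m`-block label `t`), ★ `blockMap_pow_anchor_of_underZ` (`UnderZ L j′ y w`, `j′ ≤ k` ⇒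
   `⌊(w + c_k·𝟙)∕L^{j′}⌋ = y + c_{k−j′}·𝟙` — the `ℤᵈ` content of ✓p756357 §1).
§2 ★★ `exists_rep_and_boxPlaqs_subset_of_aligned` (for `x` in an `L^j`-aligned `Y` and `n + 1 ≤ j ≤ m + K`: the representative `t := ⌊x∕L^{n+1}⌋` has `castSite t = iterBlockOf (n+1) (π x)` and
   its box plaquettes lie in `plaqsOf (π '' Y)`), ★★★ `towerBoxes_of_subset_aligned` (the `hS₀` binder VERBATIM for `S := π '' X`, `X ⊆ Y`, `Y` `L^j`-aligned, `π '' Y ⊆ Ω′`, `k ≤ j`,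
   `S₀ := plaqsOf Ω′`).
§3 ★★ `cover_anchor_mem_image_of_underZ` (the `hyS` binder VERBATIM for `S := π '' X` whenever `X` contains the anchored box `{x | ⌊x∕L^{j′}⌋ = y + c_{k−j′}·𝟙}`),
   `anchoredBox_aligned` (that box is `L^{j′}`-aligned) — so per cell the knit takes `X :=` the anchored box of the cell and `Y :=` the anchored lift of the collar.
HONEST FRAMING: count-neutral helper; cover∕floor-division bookkeeping only — nothing of [I]∕[6]∕[15] asserted or discharged; the fine letter (row (17)), the collar inclusion and the
axialities remain DISPLAYED hypotheses of the junction's knit; `NrmSymPhiOfRecord` ∕ `HThm4RecSym152PhiE(G)` ∕ `HThm4Rec*` UNDISCHARGED; N05 ∕ N07 NOT discharged; K0⁷ ∕ K1⁹ NOT closed; counts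
unmoved (typed 28∕28 · discharged 8∕28); one finite 𝕋⁴ programme at fixed ε — R4 closes the conditional finite-𝕋⁴ rung `BalabanLadder.UV` only; the YM mass gap (Clay) is NOT proved by any of
this; nothing continuum ∕ ℝ⁴ ∕ OS.  No `def`, no `instance`, no `notation`, no `sorry`.

References: [I] (0.1) p. 251, (0.3) p. 252; [6] (1.3)–(1.4) p. 77, (1.7) p. 77, (1.19) p. 79; [15] (2) p. 278, (147) p. 301.
-/

set_option autoImplicit false

noncomputable section

namespace Summit.QuantumFields.YangMills.BalabanUVNodes.N07TowerBoxPlaquettesOfAlignedRegion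

open Literature.MathematicalPhysics.QuantumFieldTheory.Balaban1983to89
open Literature.MathematicalPhysics.QuantumFieldTheory.Balaban1983to89.Node00
open Literature.MathematicalPhysics.QuantumLattice (blockMap blockBase blockMap_blockBase_add_of_lt)
open BlockAveragingZd (ctrShift)
open B8Eq119TwistedAxialRec (UnderZ flmZ underZ_iff_flmZ_eq ctrShift_add)
open T4AxialGaugeSmallField (castSite boxPlaqs)
open B8Eq17ClassAkV1 (plaqsOf mem_plaqsOf plaqsOf_mono)
open B7Prop1Explicit (e e_apply)
open B15Eq112TorusCover (cover)
open B14DomainGeom (Pt)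
open B5Eq118OneStroke (iterBlockOf)
open N07TowerCentresCoverPointwise (blockMap_add_smul_const)

variable {P : Params}

/-! ## §1  Floor-division bookkeeping -/

/-- A point of the box `[L^m·t, L^m·t + L^m − 1]` has `L^m`-block label `t`. [cite: Balaban1987RG1, (0.3) p.252 (bookkeeping)] -/
theorem blockMap_pow_eq_of_mem_box (m : ℕ) (t z : Pt P.d) (hlo : (fun i => (P.L : ℤ) ^ m * t i) ≤ z)
    (hhi : z ≤ fun i => (P.L : ℤ) ^ m * t i + ((P.L : ℤ) ^ m - 1)) : blockMap (P.L ^ m) z = t := by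
  have hs : z = blockBase (P.L ^ m) t + (z - blockBase (P.L ^ m) t) := by rw [add_sub_cancel]
  rw [hs]
  refine blockMap_blockBase_add_of_lt (P.L ^ m) t _ (fun i => ?_) (fun i => ?_)
  · have h1 : (P.L : ℤ) ^ m * t i ≤ z i := hlo i
    simp only [Pi.sub_apply, blockBase]
    push_cast
    linarith
  · have h2 : z i ≤ (P.L : ℤ) ^ m * t i + ((P.L : ℤ) ^ m - 1) := hhi i
    simp only [Pi.sub_apply, blockBase]
    push_cast
    linarith

/-- ★ **THE ANCHORED BLOCK OF A POINT UNDER `y`** (the `ℤᵈ` content of ✓p756357 §1): for `w` under `y` at depth `j′` and `j′ ≤ k`, `⌊(w + c_k·𝟙)∕L^{j′}⌋ = y + c_{k−j′}·𝟙`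
(`c_k = L^{j′}·c_{k−j′} + c_{j′}`, odd `L`). [cite: Balaban1987RG1, (0.1) p.251, (0.3) p.252; Balaban1985RegularSpaces, (1.19) p.79] -/
theorem blockMap_pow_anchor_of_underZ {k j : ℕ} (hjk : j ≤ k) {y w : Pt P.d} (hw : UnderZ P.L j y w) :
    blockMap (P.L ^ j) (w + fun _ => ((ctrShift P.L k : ℕ) : ℤ)) = y + fun _ => ((ctrShift P.L (k - j) : ℕ) : ℤ) := by
  have hc : (ctrShift P.L k : ℤ) = (P.L : ℤ) ^ j * ctrShift P.L (k - j) + ctrShift P.L j := by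
    have h := ctrShift_add P.hL.1 (k - j) j
    rwa [Nat.sub_add_cancel hjk] at h
  have hsplit : (w + fun _ => ((ctrShift P.L k : ℕ) : ℤ)) =
      (w + fun _ => ((ctrShift P.L j : ℕ) : ℤ)) + fun _ => ((P.L ^ j : ℕ) : ℤ) * (ctrShift P.L (k - j) : ℤ) := by
    funext μ
    simp only [Pi.add_apply, hc]
    push_cast
    ring
  rw [hsplit, blockMap_add_smul_const (P.L ^ j) (pow_pos P.L_pos _), blockMap_pow_add_ctrShift, (underZ_iff_flmZ_eq P.hL.1 j y w).1 hw]

/-! ## §2  The box plaquettes under the tower blocks of an aligned region -/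

/-- ★★ **TOWER BLOCK AND BOX OF A POINT OF AN ALIGNED REGION**: for `Y ⊆ ℤᵈ` `L^j`-aligned (with every point it contains its whole `L^j`-box), `x ∈ Y` and `n + 1 ≤ j ≤ m + K`: the
representative `t := ⌊x∕L^{n+1}⌋` satisfies `castSite t = iterBlockOf (n+1) (π x)` and the plaquettes of the fine box `[L^{n+1}·t, L^{n+1}·t + L^{n+1} − 1]` have their base points in
`π '' Y` — they lie in `plaqsOf (π '' Y)`. [cite: Balaban1987RG1, (0.1) p.251, (0.3) p.252; Balaban1985RegularSpaces, (1.7) p.77, p.77 (convention before (1.5)); Balaban1985Variational, (2) p.278] -/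
theorem exists_rep_and_boxPlaqs_subset_of_aligned {j n : ℕ} (hn : n + 1 ≤ j) (hj : j ≤ P.m + P.K) (Y : Set (Pt P.d))
    (hY : ∀ x ∈ Y, ∀ z : Pt P.d, blockMap (P.L ^ j) z = blockMap (P.L ^ j) x → z ∈ Y) {x : Pt P.d} (hx : x ∈ Y) :
    ∃ t : Fin P.d → ℤ, (castSite t : Site P (n + 1)) = iterBlockOf (n + 1) (cover P x) ∧
      boxPlaqs (fun i => (P.L : ℤ) ^ (n + 1) * t i) (fun i => (P.L : ℤ) ^ (n + 1) * t i + ((P.L : ℤ) ^ (n + 1) - 1)) ⊆ plaqsOf (cover P '' Y) := by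
  refine ⟨blockMap (P.L ^ (n + 1)) x, ?_, ?_⟩
  · rw [iterBlockOf_cover (hn.trans hj) x]; rfl
  · rintro p ⟨z, hlo, hhi, hsrc⟩
    rw [mem_plaqsOf]
    left
    have he : ∀ (μ : Fin P.d) (i : Fin P.d), (0 : ℤ) ≤ e μ i := fun μ i => by
      rw [e_apply]; split_ifs <;> norm_num
    have hhi' : z ≤ fun i => (P.L : ℤ) ^ (n + 1) * blockMap (P.L ^ (n + 1)) x i + ((P.L : ℤ) ^ (n + 1) - 1) := by
      intro i
      have h := hhi i
      have h1 := he p.μ i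
      have h2 := he p.ν i
      simp only [Pi.add_apply] at h ⊢
      linarith
    have hz : blockMap (P.L ^ (n + 1)) z = blockMap (P.L ^ (n + 1)) x := blockMap_pow_eq_of_mem_box (n + 1) _ z hlo hhi'
    have hzY : z ∈ Y := by
      refine hY x hx z ?_
      obtain ⟨r, hr⟩ : ∃ r, j = (n + 1) + r := ⟨j - (n + 1), by omega⟩
      rw [hr, pow_add, ← blockMap_blockMap, ← blockMap_blockMap, hz]
    rw [hsrc]
    exact ⟨z, hzY, rfl⟩

/-- ★★★ **THE `hS₀` BINDER OF THE (σ2) SUPPLIER, DISCHARGED**: for `X ⊆ Y ⊆ ℤᵈ` with `Y` `L^j`-aligned and `π '' Y ⊆ Ω′`, and `k ≤ j ≤ m + K`: every `w ∈ π '' X` and every `n < k` admit a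
representative `t` with `castSite t = iterBlockOf (n+1) w` whose box plaquettes lie in `plaqsOf Ω′` — VERBATIM the `hS₀` hypothesis of `…N07SymTauTowerStatementOfFinePlaquettes` ∕
`…N07SymTauCellRowOfFinePlaquettes` with `S := π '' X`, `S₀ := plaqsOf Ω′` (row (17)'s plaquette set `Sect2.omegaPlaqsTop s.Ω · (j−1) = plaqsOf Ω_{j−1}` on the collar).
[cite: Balaban1987RG1, (0.1) p.251, (0.3) p.252; Balaban1985RegularSpaces, (1.7) p.77; Balaban1985Variational, (2) p.278, (147) p.301] -/
theorem towerBoxes_of_subset_aligned {j k : ℕ} (hkj : k ≤ j) (hj : j ≤ P.m + P.K) {X Y : Set (Pt P.d)} (hXY : X ⊆ Y)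
    (hY : ∀ x ∈ Y, ∀ z : Pt P.d, blockMap (P.L ^ j) z = blockMap (P.L ^ j) x → z ∈ Y) {Ω' : Set (Site P 0)} (hYΩ : cover P '' Y ⊆ Ω') :
    ∀ n, n < k → ∀ w ∈ cover P '' X, ∃ t : Fin P.d → ℤ, (castSite t : Site P (n + 1)) = iterBlockOf (n + 1) w ∧
      boxPlaqs (fun i => (P.L : ℤ) ^ (n + 1) * t i) (fun i => (P.L : ℤ) ^ (n + 1) * t i + ((P.L : ℤ) ^ (n + 1) - 1)) ⊆ plaqsOf Ω' := by
  rintro n hn w ⟨x, hx, rfl⟩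
  obtain ⟨t, ht, hbox⟩ := exists_rep_and_boxPlaqs_subset_of_aligned (j := j) (n := n) (by omega) hj Y hY (hXY hx)
  exact ⟨t, ht, hbox.trans (plaqsOf_mono hYΩ)⟩

/-! ## §3  The cell's fine shadow -/

/-- ★★ **THE `hyS` BINDER OF THE (σ2) SUPPLIER, DISCHARGED**: if `X` contains the anchored box `{x | ⌊x∕L^{j′}⌋ = y + c_{k−j′}·𝟙}` of the cell anchor `y` (depth `j′ ≤ k`), then every `w` under
`y` has `π(w + c_k·𝟙) ∈ π '' X`. [cite: Balaban1987RG1, (0.1) p.251, (0.3) p.252; Balaban1985RegularSpaces, (1.19) p.79] -/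
theorem cover_anchor_mem_image_of_underZ {k j : ℕ} (hjk : j ≤ k) (y : Pt P.d) {X : Set (Pt P.d)}
    (hX : ∀ x : Pt P.d, blockMap (P.L ^ j) x = (y + fun _ => ((ctrShift P.L (k - j) : ℕ) : ℤ)) → x ∈ X) :
    ∀ w, UnderZ P.L j y w → cover P (w + fun _ => ((ctrShift P.L k : ℕ) : ℤ)) ∈ cover P '' X :=
  fun w hw => ⟨w + fun _ => ((ctrShift P.L k : ℕ) : ℤ), hX _ (blockMap_pow_anchor_of_underZ hjk hw), rfl⟩

/-- **THE ANCHORED BOX IS ALIGNED** at its own level: `{x | ⌊x∕L^{j′}⌋ = b}` contains with every point its whole `L^{j′}`-box. [cite: Balaban1987RG1, (0.3) p.252 (bookkeeping)] -/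
theorem anchoredBox_aligned (j : ℕ) (b : Pt P.d) :
    ∀ x ∈ {x : Pt P.d | blockMap (P.L ^ j) x = b}, ∀ z : Pt P.d, blockMap (P.L ^ j) z = blockMap (P.L ^ j) x → z ∈ {x : Pt P.d | blockMap (P.L ^ j) x = b} :=
  fun _ hx _ hz => hz.trans hx

/-- **A UNION OF `L^j`-BOXES IS ALIGNED**: `{x | ⌊x∕L^j⌋ ∈ T}` contains with every point its whole `L^j`-box (the shape of the anchored lift of a collar ∕ window made of `j`-blocks).
[cite: Balaban1987RG1, (0.3) p.252 (bookkeeping)] -/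
theorem blockUnion_aligned (j : ℕ) (T : Set (Pt P.d)) :
    ∀ x ∈ {x : Pt P.d | blockMap (P.L ^ j) x ∈ T}, ∀ z : Pt P.d, blockMap (P.L ^ j) z = blockMap (P.L ^ j) x → z ∈ {x : Pt P.d | blockMap (P.L ^ j) x ∈ T} :=
  fun _ hx _ hz => by simp only [Set.mem_setOf_eq] at hx ⊢; rw [hz]; exact hx

/-- **THE ANCHORED BOX OF A CELL LIES IN THE BLOCK UNION OF ITS WINDOW**: if the `L^j`-block label of the cell's anchored box label belongs to `T` (`j′ ≤ j`), the anchored `L^{j′}`-box of the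
cell is contained in `{x | ⌊x∕L^j⌋ ∈ T}`. [cite: Balaban1987RG1, (0.3) p.252 (bookkeeping)] -/
theorem anchoredBox_subset_blockUnion {j j' : ℕ} (hj : j' ≤ j) (b : Pt P.d) (T : Set (Pt P.d)) (hb : blockMap (P.L ^ (j - j')) b ∈ T) :
    {x : Pt P.d | blockMap (P.L ^ j') x = b} ⊆ {x : Pt P.d | blockMap (P.L ^ j) x ∈ T} := by
  intro x hx
  simp only [Set.mem_setOf_eq] at hx ⊢
  obtain ⟨r, hr⟩ : ∃ r, j = j' + r := ⟨j - j', by omega⟩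
  have hr' : j - j' = r := by omega
  rw [hr, pow_add, ← blockMap_blockMap, hx, ← hr']
  exact hb

end Summit.QuantumFields.YangMills.BalabanUVNodes.N07TowerBoxPlaquettesOfAlignedRegion

end
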